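import Summits.SmoothPoincare4.SmoothPoincare4.Theorems.WeakReductionDescentWeakReductionReducesStubLoopFromGenusThreeAux4
import Literature.Topology.FourManifolds.CircleSurgeryEulerProofs
import Literature.Topology.FourManifolds.CircleSurgeryFundamentalGroupProofs

/-!
# Crux `WeakReductionReduces` (stmt-SmoothPoincare4-17908), line `loop_dichotomy`, stub L₃ —
# auxiliary file 5: `stub_loopFromGenusThree` from Meier–Schirmer–Zupan 2016 ALONE

Two of the three named facts used by `helper_loopFromGenusThree_of_facts` (auxiliary file 4)
have since been DISCHARGED in the tree:

* `Literature.Topology.FourManifolds.circleSurgery_relEuler_eq_add_two_holds`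
  (`CircleSurgeryEulerProofs.lean`) — `χ(X_ℓ) = χ(X) + 2` for a circle surgery in dimension `4`
  (Kosinski VI/VII, Kirby I §2; Mayer–Vietoris / excision Euler counts);
* `Literature.Topology.FourManifolds.circleSurgery_normalClosure_loop_eq_top_holds`
  (`CircleSurgeryFundamentalGroupProofs.lean`) — Juhász 2023, Lemma 2.56 (Kosinski VII (1.2)) in
  the form "`X_ℓ` simply connected ⇒ `[ℓ]` normally generates `π₁(X)`" (van Kampen, kernel form).

Feeding them in leaves stub L₃ (`stub_loopFromGenusThree`, VERBATIM: a smooth homotopy `4`-sphere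
obtained by surgery on a loop in a closed smooth `4`-manifold carrying a GK-trisection of genus
`≤ 3` is diffeomorphic to `S⁴`) conditional on EXACTLY ONE published fact, the genuinely external
input of its proof sketch:

* `Literature.Topology.FourManifolds.msz_chiZero_circleProdSphereThree_gk` — J. Meier,
  T. Schirmer, A. Zupan, Proc. AMS 144 (2016), Thm. 1.2 (arXiv:1507.06561 numbering) with
  Gay–Kirby's Remark 2, in the range `χ = 0`: a closed connected oriented smooth `4`-manifold with
  a `(g; k₀, k₁, k₂)`-GK-trisection, some `kᵢ ≥ g − 1` and `Σ kᵢ = g + 2`, is diffeomorphic to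
  `S¹ × S³`.

## References

* [MeierSchirmerZupan2016] Thm. 1.2, Remark 3.12 · [GayKirby2016] Remark 2 ·
  [ArandaZupan2025] §2 p. 7, §5–§6 · [Pao1977] · [Juhasz2023] Lemma 2.56 · [Kosinski1993]
  VI (9.2), (10.1), VII §1.
-/

-- the registered namespace `Summit.SmoothPoincare4.SmoothPoincare4.Theorems…` repeats a component
set_option linter.dupNamespace false

noncomputable section

open scoped Manifold ContDiff Topology ContinuousMap

namespace Summit.SmoothPoincare4.SmoothPoincare4.Theorems.WeakReductionReduces.LoopDichotomy

/-- **L₃ from Meier–Schirmer–Zupan 2016 alone** (`stub_loopFromGenusThree` of line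
`loop_dichotomy`, VERBATIM, conditional ONLY on the named fact
`Literature.Topology.FourManifolds.msz_chiZero_circleProdSphereThree_gk`, MSZ16 Thm. 1.2 in the
`χ = 0` range; D-0014): `helper_loopFromGenusThree_of_facts` (auxiliary file 4) with its `χ`- and
`π₁`-hypotheses discharged by the tree's theorems `circleSurgery_relEuler_eq_add_two_holds` and
`circleSurgery_normalClosure_loop_eq_top_holds`.  A smooth homotopy `4`-sphere `M` obtained by
surgery (either framing) on a smoothly embedded loop `ℓ` in a closed smooth `X` with a
GK-trisection of genus `g′ ≤ 3` is diffeomorphic to `S⁴`. [cite: MeierSchirmerZupan2016, Thm. 1.2 (arXiv numbering)]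
[cite: ArandaZupan2025, §2 p. 7 and §5–§6] [cite: Pao1977, Thm] -/
theorem helper_loopFromGenusThree_of_msz :
    Literature.Topology.FourManifolds.msz_chiZero_circleProdSphereThree_gk.{0} → ∀ (X : Type) [TopologicalSpace X] [T2Space X] [SecondCountableTopology X] [ChartedSpace (EuclideanSpace ℝ (Fin 4)) X] [IsManifold (𝓡 4) ((⊤ : ℕ∞) : WithTop ℕ∞) X] (g' : ℕ) (k' : Fin 3 → ℕ) (T' : Fin 3 → Set X), Literature.Topology.FourManifolds.IsGKTrisection X g' k' T' → g' ≤ 3 → ∀ (ℓ : (Metric.sphere (0 : EuclideanSpace ℝ (Fin 2)) 1) → X), Manifold.IsSmoothEmbedding (𝓡 1) (𝓡 4) ((⊤ : ℕ∞) : WithTop ℕ∞) ℓ → ∀ (M : Type) [TopologicalSpace M] [T2Space M] [SecondCountableTopology M] [ChartedSpace (EuclideanSpace ℝ (Fin 4)) M] [IsManifold (𝓡 4) ((⊤ : ℕ∞) : WithTop ℕ∞) M], (M ≃ₕ (Metric.sphere (0 : EuclideanSpace ℝ (Fin 5)) 1)) → Literature.Topology.FourManifolds.IsCircleSurgery (𝓡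 4) (𝓡 4) X M ℓ → Nonempty (Diffeomorph (𝓡 4) (𝓡 4) M (Metric.sphere (0 : EuclideanSpace ℝ (Fin 5)) 1) ((⊤ : ℕ∞) : WithTop ℕ∞)) :=
  fun hMSZ ↦ helper_loopFromGenusThree_of_facts hMSZ
    Literature.Topology.FourManifolds.circleSurgery_relEuler_eq_add_two_holds
    Literature.Topology.FourManifolds.circleSurgery_normalClosure_loop_eq_top_holds

end Summit.SmoothPoincare4.SmoothPoincare4.Theorems.WeakReductionReduces.LoopDichotomy

end
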